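import Summits.CriticalPhenomena.PercolationContinuityZ3.Theorems.PercNearOneGluingNoHeavyConstsClusterSquareRootedC4
import Summits.CriticalPhenomena.PercolationContinuityZ3.Theorems.PercNearOneGluingNoHeavyConstsClusterSquareW4MinorConverse
import Summits.CriticalPhenomena.PercolationContinuityZ3.Theorems.PercNearOneGluingNoHeavyConstsClusterSquareUnlinked
import HarnessLib

/-!
# Theorem D: a double clash is a `K₂,₃` minor rooted at `{a, b, c}` — CSQ, DUU, TS for planar graphs with the terminals on one face

builds on p205010 (kernel theorem, internal audit signed; external expert review pending)

PAPER-2 track "percolation constants", part (ii), seat `prim-consts-1`, gen 23 (lane index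
`run/shared/lean/prim/consts/CONSTANTS.md`, row A19; memo `FROM-prim-consts-1-g23-SERIES-PARALLEL.md` §3).
Support file for the crux `NoHeavyLowerTail` (stmt-CriticalPhenomena-4575; `--supports`).  Theorems only; no definitions, no sorries.

THE RESULT.  Call a ROOTED `K₂,₃` MINOR AT `{a, b, c}` five pairwise disjoint vertex sets `A ∋ a`, `B ∋ b`, `C ∋ c`, `X`, `X'`, each inducing
a connected subgraph, with `X` and `X'` both joined by edges to each of `A, B, C`.
* **`Consts.noDoubleClash_of_noRootedK23`**: if the graph `H ⊇` positive pairs has no rooted `K₂,₃` minor at `{a,b,c}` then no cluster of `a`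
  is doubly linked to `{b, c}` (hypothesis `hK` of gen 17's `Consts.not_doubleClash_of_unlinked`); hence
  **`Consts.clusterSquare_le_sq_of_noRootedK23`, `Consts.sq_real_split_le_of_noRootedK23`, `Consts.tripleSplit_of_noRootedK23`** — CSQ and
  DUU at `(a; b, c)` and TS for `{a, b, c}`.  The hypothesis is SYMMETRIC in `a, b, c`, so CSQ/DUU hold at all three roots.
* EXACTNESS (`Consts.doubleLinkage_of_rootedK23`): a rooted `K₂,₃` minor at `{a,b,c}` IS a double linkage at the root `a` (`K = A`, clash
  vertices in `X, X'`), so "no double linkage at `a`" ⟺ "no rooted `K₂,₃` at `{a,b,c}`" ⟺ "no double linkage at `b`" — the structural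
  no-double-clash condition does not depend on the root.
* CONE FORM (`Consts.noDoubleClash_of_noK33Cone`, `Consts.tripleSplit_of_noK33Cone`): a rooted `K₂,₃` plus a new vertex `∞ ~ a, b, c` is a `K₃,₃`;
  so the conclusions hold whenever some graph `Hp ⊇ cone(H; a,b,c)` on `Option V` has no `K₃,₃` model — in particular (Kuratowski–Wagner,
  informal) for every PLANAR `H` with `a, b, c` on a COMMON FACE: the lane's THEOREM D (memos g17 §0(6), g21 §0(5)).
PROOF.  A double clash gives `K = C_a(ω) ∋ a`, clash vertices `y, y' ∉ K ∪ {a,b,c}` adjacent to `K`, and `K`-avoiding walks `y→b ∥ y'→c`,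
`y→c ∥ y'→b` (gen 17); `Consts.Minor.rootedC4_of_crossLinkages` (`…RootedC4.lean`) turns them into a rooted `C₄` `B∋b ~ X∋y ~ C∋c ~ X'∋y' ~ B`
off `K`; with `A = K` (`K ~ X, X'` through `y, y'`) this is a rooted `K₂,₃`.
Census (lane g23, exact; `prim-consts-1/g23/eng/tadl.py`, `taql.py`): structural double linkage at `(a;{b,c})` ⟹ `K₃,₃` minor of the cone on all
7 428 rooted instances with `n ≤ 6` (1 494 linked) and all 89 565 with `n = 7`; at `n ≤ 6` the converse also holds instance-wise (every
structurally unlinked instance has a `K₃,₃`-free cone).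
References: N. Gladkov, arXiv:2408.08457v2 (2024), Thm. 4.3, Thm. 5.2, Cor. 5.3, Thm. 6.1 (planar motivation); R. Diestel, Graph Theory
(5th ed.), §1.7 (minors as branch sets), §4.4 (Kuratowski–Wagner; used only informally).
-/

noncomputable section

namespace Summit.CriticalPhenomena.PercolationContinuityZ3.Theorems

open MeasureTheory Literature.Probability.LatticeModels Literature.Probability.Percolation

namespace Consts

namespace Minor

variable {V : Type*} {H : SimpleGraph V} {Hp : SimpleGraph (Option V)}

/-- The image under `some` of an induced-connected set is induced-connected in any graph on `Option V` containing the image edges.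
[folklore] -/
theorem induce_connected_image_some (hHp : ∀ u v, H.Adj u v → Hp.Adj (some u) (some v)) {S : Set V}
    (hS : (H.induce S).Connected) : (Hp.induce (some '' S)).Connected := by
  let f : H.induce S →g Hp.induce (some '' S) :=
    { toFun := fun x => ⟨some x.1, x.1, x.2, rfl⟩
      map_rel' := fun {x y} h => hHp _ _ h }
  refine hS.map f ?_
  rintro ⟨w, x, hx, rfl⟩
  exact ⟨⟨x, hx⟩, rfl⟩

/-- A singleton induces a connected subgraph. [folklore] -/
theorem induce_singleton_connected {W : Type*} (G : SimpleGraph W) (x : W) : (G.induce ({x} : Set W)).Connected := by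
  rw [SimpleGraph.connected_iff]
  refine ⟨fun u v => ?_, ⟨⟨x, rfl⟩⟩⟩
  have h : u = v := Subtype.ext ((Set.mem_singleton_iff.mp u.2).trans (Set.mem_singleton_iff.mp v.2).symm)
  rw [h]

/-- Disjoint sets have disjoint `some`-images. [folklore] -/
theorem disjoint_image_some {S T : Set V} (h : Disjoint S T) : Disjoint (some '' S) (some '' T) :=
  (Set.disjoint_image_iff (Option.some_injective V)).mpr h

/-- `none` is not in a `some`-image. [folklore] -/
theorem disjoint_none_image (S : Set V) : Disjoint ({none} : Set (Option V)) (some '' S) := by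
  refine Set.disjoint_left.mpr fun x hx hx' => ?_
  obtain ⟨u, _, rfl⟩ := hx'
  exact Option.some_ne_none u hx

/-- Adjacency between sets lifts to their `some`-images. [folklore] -/
theorem adj_image_some (hHp : ∀ u v, H.Adj u v → Hp.Adj (some u) (some v)) {S T : Set V}
    (h : ∃ u ∈ S, ∃ v ∈ T, H.Adj u v) : ∃ u ∈ some '' S, ∃ v ∈ some '' T, Hp.Adj u v := by
  obtain ⟨u, hu, v, hv, huv⟩ := h
  exact ⟨some u, ⟨u, hu, rfl⟩, some v, ⟨v, hv, rfl⟩, hHp u v huv⟩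

end Minor

open Minor

/-! ### No double clash without a rooted `K₂,₃` -/

/-- **A double clash at `(a; b, c)` is a `K₂,₃` minor rooted at `{a, b, c}`.**  If `H` has no five pairwise disjoint vertex sets
`A ∋ a, B ∋ b, C ∋ c, X, X'`, each inducing a connected subgraph, with `X` and `X'` both adjacent to each of `A, B, C`, then the hypothesis
`hK` of `Consts.not_doubleClash_of_unlinked` holds at `(a; b, c)`. [cite: Diestel2017, §1.7 (minors as branch sets)] -/
theorem noDoubleClash_of_noRootedK23 {V : Type*} [DecidableEq V] (H : SimpleGraph V) {a b c : V}
    (hK23 : ∀ A B C X X' : Set V, a ∈ A → b ∈ B → c ∈ C →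
      (H.induce A).Connected → (H.induce B).Connected → (H.induce C).Connected → (H.induce X).Connected → (H.induce X').Connected →
      Disjoint A B → Disjoint A C → Disjoint A X → Disjoint A X' → Disjoint B C → Disjoint B X → Disjoint B X' →
      Disjoint C X → Disjoint C X' → Disjoint X X' →
      (∃ u ∈ X, ∃ v ∈ A, H.Adj u v) → (∃ u ∈ X, ∃ v ∈ B, H.Adj u v) → (∃ u ∈ X, ∃ v ∈ C, H.Adj u v) →
      (∃ u ∈ X', ∃ v ∈ A, H.Adj u v) → (∃ u ∈ X', ∃ v ∈ B, H.Adj u v) → (∃ u ∈ X', ∃ v ∈ C, H.Adj u v) → False) :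
    ∀ (K : Set V) (y y' : V), a ∈ K → b ∉ K → c ∉ K →
      (∀ T : Set V, a ∈ T → (∀ u x, u ∈ T → H.Adj u x → x ∈ K → x ∈ T) → K ⊆ T) →
      y ∉ K → y' ∉ K → (∃ k, k ∈ K ∧ H.Adj k y) → (∃ k, k ∈ K ∧ H.Adj k y') →
      y ≠ a → y ≠ b → y ≠ c → y' ≠ a → y' ≠ b → y' ≠ c → y ≠ y' →
      (∀ (P₁ : H.Walk y b) (P₂ : H.Walk y' c), (∀ x ∈ P₁.support, x ∉ K) → (∀ x ∈ P₂.support, x ∉ K) →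
          ∃ x, x ∈ P₁.support ∧ x ∈ P₂.support) ∨
      (∀ (Q₁ : H.Walk y c) (Q₂ : H.Walk y' b), (∀ x ∈ Q₁.support, x ∉ K) → (∀ x ∈ Q₂.support, x ∉ K) →
          ∃ x, x ∈ Q₁.support ∧ x ∈ Q₂.support) := by
  intro K y y' haK hbK hcK hcl hyK hy'K hky hky' _ _ _ _ _ _ _
  by_contra hcon
  rw [not_or] at hcon
  obtain ⟨h12, h34⟩ := hcon
  push Not at h12 h34
  obtain ⟨P₁, P₂, hP₁K, hP₂K, hd12⟩ := h12
  obtain ⟨Q₁, Q₂, hQ₁K, hQ₂K, hd34⟩ := h34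
  have rv : ∀ {u v : V} (W : H.Walk u v) (x : V), x ∈ W.reverse.support ↔ x ∈ W.support := fun W x => by
    rw [SimpleGraph.Walk.support_reverse, List.mem_reverse]
  obtain ⟨B, X, C, X', hbB, hyX, hcC, hy'X', cB, cX, cC, cX', e1, e2, e3, e4, e5, e6, a1, a2, a3, a4, hsub⟩ :=
    rootedC4_of_crossLinkages P₁.reverse P₂.reverse Q₂.reverse Q₁.reverse
      (fun x hx hx' => hd12 x ((rv P₁ x).mp hx) ((rv P₂ x).mp hx'))
      (fun x hx hx' => hd34 x ((rv Q₁ x).mp hx') ((rv Q₂ x).mp hx))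
  have hoff : ∀ x ∈ B ∪ X ∪ C ∪ X', x ∉ K := by
    intro x hx
    rcases hsub x hx with h | h | h | h
    · exact hP₁K x ((rv P₁ x).mp h)
    · exact hP₂K x ((rv P₂ x).mp h)
    · exact hQ₂K x ((rv Q₂ x).mp h)
    · exact hQ₁K x ((rv Q₁ x).mp h)
  have dK : ∀ S : Set V, (∀ x ∈ S, x ∈ B ∪ X ∪ C ∪ X') → Disjoint K S := fun S hS =>
    Set.disjoint_left.mpr fun x hxK hxS => hoff x (hS x hxS) hxK
  obtain ⟨k, hk, hky⟩ := hky
  obtain ⟨k', hk', hk'y'⟩ := hky'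
  obtain ⟨u₁, hu₁, v₁, hv₁, e₁⟩ := a1
  obtain ⟨u₂, hu₂, v₂, hv₂, e₂⟩ := a2
  obtain ⟨u₃, hu₃, v₃, hv₃, e₃⟩ := a3
  exact hK23 K B C X X' haK hbB hcC (induce_connected_of_closure haK hcl) cB cC cX cX'
    (dK B fun x hx => Or.inl (Or.inl (Or.inl hx))) (dK C fun x hx => Or.inl (Or.inr hx))
    (dK X fun x hx => Or.inl (Or.inl (Or.inr hx))) (dK X' fun x hx => Or.inr hx) e2 e1 e3 e4.symm e6 e5
    ⟨y, hyX, k, hk, hky.symm⟩ ⟨v₁, hv₁, u₁, hu₁, e₁.symm⟩ ⟨u₂, hu₂, v₂, hv₂, e₂⟩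
    ⟨y', hy'X', k', hk', hk'y'.symm⟩ a4 ⟨v₃, hv₃, u₃, hu₃, e₃.symm⟩

/-- **Exactness: a rooted `K₂,₃` at `{a, b, c}` is a double linkage at the root `a`** — the negation of `hK` of
`Consts.not_doubleClash_of_unlinked` (with `K = A`).  Hence the structural no-double-clash condition is the same at the three roots.
[cite: Diestel2017, §1.7 (minors as branch sets)] -/
theorem doubleLinkage_of_rootedK23 {V : Type*} (H : SimpleGraph V) {a b c : V} {A B C X X' : Set V}
    (haA : a ∈ A) (hbB : b ∈ B) (hcC : c ∈ C)
    (cA : (H.induce A).Connected) (cB : (H.induce B).Connected) (cC : (H.induce C).Connected) (cX : (H.induce X).Connected)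
    (cX' : (H.induce X').Connected)
    (dAB : Disjoint A B) (dAC : Disjoint A C) (dAX : Disjoint A X) (dAX' : Disjoint A X') (dBC : Disjoint B C) (dBX : Disjoint B X)
    (dBX' : Disjoint B X') (dCX : Disjoint C X) (dCX' : Disjoint C X') (dXX' : Disjoint X X')
    (xA : ∃ u ∈ X, ∃ v ∈ A, H.Adj u v) (xB : ∃ u ∈ X, ∃ v ∈ B, H.Adj u v) (xC : ∃ u ∈ X, ∃ v ∈ C, H.Adj u v)
    (x'A : ∃ u ∈ X', ∃ v ∈ A, H.Adj u v) (x'B : ∃ u ∈ X', ∃ v ∈ B, H.Adj u v) (x'C : ∃ u ∈ X', ∃ v ∈ C, H.Adj u v) :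
    ∃ (y y' : V), a ∈ A ∧ b ∉ A ∧ c ∉ A ∧
      (∀ T : Set V, a ∈ T → (∀ u x, u ∈ T → H.Adj u x → x ∈ A → x ∈ T) → A ⊆ T) ∧
      y ∉ A ∧ y' ∉ A ∧ (∃ k, k ∈ A ∧ H.Adj k y) ∧ (∃ k, k ∈ A ∧ H.Adj k y') ∧
      y ≠ a ∧ y ≠ b ∧ y ≠ c ∧ y' ≠ a ∧ y' ≠ b ∧ y' ≠ c ∧ y ≠ y' ∧
      (∃ (P₁ : H.Walk y b) (P₂ : H.Walk y' c), (∀ x ∈ P₁.support, x ∉ A) ∧ (∀ x ∈ P₂.support, x ∉ A) ∧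
          ∀ x, x ∈ P₁.support → x ∉ P₂.support) ∧
      (∃ (Q₁ : H.Walk y c) (Q₂ : H.Walk y' b), (∀ x ∈ Q₁.support, x ∉ A) ∧ (∀ x ∈ Q₂.support, x ∉ A) ∧
          ∀ x, x ∈ Q₁.support → x ∉ Q₂.support) := by
  have dis := fun {S T : Set V} (h : Disjoint S T) {x : V} (hs : x ∈ S) (ht : x ∈ T) => Set.disjoint_left.mp h hs ht
  obtain ⟨y, hyX, k, hk, hyk⟩ := xA
  obtain ⟨y', hy'X', k', hk', hy'k'⟩ := x'A
  obtain ⟨p, hp, q, hq, hpq⟩ := xB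
  obtain ⟨p', hp', q', hq', hp'q'⟩ := xC
  obtain ⟨r, hr, s, hs, hrs⟩ := x'B
  obtain ⟨r', hr', s', hs', hr's'⟩ := x'C
  -- unions `X ∪ B`, `X' ∪ C`, `X ∪ C`, `X' ∪ B` are connected
  have cXB : (H.induce (X ∪ B)).Connected := SimpleGraph.connected_induce_union cX.preconnected cB.preconnected hp hq hpq
  have cX'C : (H.induce (X' ∪ C)).Connected := SimpleGraph.connected_induce_union cX'.preconnected cC.preconnected hr' hs' hr's'
  have cXC : (H.induce (X ∪ C)).Connected := SimpleGraph.connected_induce_union cX.preconnected cC.preconnected hp' hq' hp'q'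
  have cX'B : (H.induce (X' ∪ B)).Connected := SimpleGraph.connected_induce_union cX'.preconnected cB.preconnected hr hs hrs
  obtain ⟨P₁, hP₁⟩ := exists_walk_of_induce_connected cXB (Or.inl hyX) (Or.inr hbB)
  obtain ⟨P₂, hP₂⟩ := exists_walk_of_induce_connected cX'C (Or.inl hy'X') (Or.inr hcC)
  obtain ⟨Q₁, hQ₁⟩ := exists_walk_of_induce_connected cXC (Or.inl hyX) (Or.inr hcC)
  obtain ⟨Q₂, hQ₂⟩ := exists_walk_of_induce_connected cX'B (Or.inl hy'X') (Or.inr hbB)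
  -- closure form of the connectivity of `A`
  have hcl : ∀ T : Set V, a ∈ T → (∀ u x, u ∈ T → H.Adj u x → x ∈ A → x ∈ T) → A ⊆ T := by
    intro T haT hT z hz
    obtain ⟨W, hW⟩ := exists_walk_of_induce_connected cA haA hz
    suffices key : ∀ (u v : V) (W : H.Walk u v), u ∈ T → (∀ x ∈ W.support, x ∈ A) → v ∈ T from key a z W haT hW
    intro u v W
    induction W with
    | nil => exact fun hu _ => hu
    | @cons u x v hux W' ih =>
      intro hu hA
      exact ih (hT u x hu hux (hA x (List.mem_cons_of_mem _ W'.start_mem_support))) fun t ht => hA t (List.mem_cons_of_mem _ ht)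
  have avoid : ∀ {S₁ S₂ : Set V}, Disjoint A S₁ → Disjoint A S₂ → ∀ {u v : V} (W : H.Walk u v),
      (∀ x ∈ W.support, x ∈ S₁ ∪ S₂) → ∀ x ∈ W.support, x ∉ A := by
    intro S₁ S₂ h1 h2 u v W hW x hx hxA
    rcases hW x hx with h | h
    · exact dis h1 hxA h
    · exact dis h2 hxA h
  refine ⟨y, y', haA, fun h => dis dAB h hbB, fun h => dis dAC h hcC, hcl, fun h => dis dAX h hyX, fun h => dis dAX' h hy'X',
    ⟨k, hk, hyk.symm⟩, ⟨k', hk', hy'k'.symm⟩, fun h => dis dAX (h ▸ haA) hyX, fun h => dis dBX (h ▸ hbB) hyX,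
    fun h => dis dCX (h ▸ hcC) hyX, fun h => dis dAX' (h ▸ haA) hy'X', fun h => dis dBX' (h ▸ hbB) hy'X',
    fun h => dis dCX' (h ▸ hcC) hy'X', fun h => dis dXX' hyX (h ▸ hy'X'),
    ⟨P₁, P₂, avoid dAX dAB P₁ hP₁, avoid dAX' dAC P₂ hP₂, fun x h1 h2 => ?_⟩,
    ⟨Q₁, Q₂, avoid dAX dAC Q₁ hQ₁, avoid dAX' dAB Q₂ hQ₂, fun x h1 h2 => ?_⟩⟩
  · rcases hP₁ x h1 with h | h <;> rcases hP₂ x h2 with h' | h'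
    · exact dis dXX' h h'
    · exact dis dCX h' h
    · exact dis dBX' h h'
    · exact dis dBC h h'
  · rcases hQ₁ x h1 with h | h <;> rcases hQ₂ x h2 with h' | h'
    · exact dis dXX' h h'
    · exact dis dBX h' h
    · exact dis dCX' h h'
    · exact dis dBC h' h

/-! ### The cone form -/

/-- **Cone form.**  If some graph `Hp` on `Option V` containing the cone of `H` over `{a, b, c}` (`some`-edges of `H`; `none ~ some a, some b,
some c`) has no `K₃,₃` model, then `H` has no rooted `K₂,₃` at `{a,b,c}`; hence hypothesis `hK` of `Consts.not_doubleClash_of_unlinked`.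
For planar `H` with `a, b, c` on a common face the cone is planar. [cite: Diestel2017, §1.7, §4.4 (Kuratowski–Wagner)] -/
theorem noDoubleClash_of_noK33Cone {V : Type*} [DecidableEq V] (H : SimpleGraph V) (Hp : SimpleGraph (Option V))
    (hHp : ∀ u v, H.Adj u v → Hp.Adj (some u) (some v)) {a b c : V}
    (ha : Hp.Adj none (some a)) (hb : Hp.Adj none (some b)) (hc : Hp.Adj none (some c))
    (hK33 : ∀ L₁ L₂ L₃ R₁ R₂ R₃ : Set (Option V),
      (Hp.induce L₁).Connected → (Hp.induce L₂).Connected → (Hp.induce L₃).Connected →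
      (Hp.induce R₁).Connected → (Hp.induce R₂).Connected → (Hp.induce R₃).Connected →
      Disjoint L₁ L₂ → Disjoint L₁ L₃ → Disjoint L₂ L₃ → Disjoint R₁ R₂ → Disjoint R₁ R₃ → Disjoint R₂ R₃ →
      Disjoint L₁ R₁ → Disjoint L₁ R₂ → Disjoint L₁ R₃ → Disjoint L₂ R₁ → Disjoint L₂ R₂ → Disjoint L₂ R₃ →
      Disjoint L₃ R₁ → Disjoint L₃ R₂ → Disjoint L₃ R₃ →
      (∃ u ∈ L₁, ∃ v ∈ R₁, Hp.Adj u v) → (∃ u ∈ L₁, ∃ v ∈ R₂, Hp.Adj u v) → (∃ u ∈ L₁, ∃ v ∈ R₃, Hp.Adj u v) →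
      (∃ u ∈ L₂, ∃ v ∈ R₁, Hp.Adj u v) → (∃ u ∈ L₂, ∃ v ∈ R₂, Hp.Adj u v) → (∃ u ∈ L₂, ∃ v ∈ R₃, Hp.Adj u v) →
      (∃ u ∈ L₃, ∃ v ∈ R₁, Hp.Adj u v) → (∃ u ∈ L₃, ∃ v ∈ R₂, Hp.Adj u v) → (∃ u ∈ L₃, ∃ v ∈ R₃, Hp.Adj u v) → False) :
    ∀ (K : Set V) (y y' : V), a ∈ K → b ∉ K → c ∉ K →
      (∀ T : Set V, a ∈ T → (∀ u x, u ∈ T → H.Adj u x → x ∈ K → x ∈ T) → K ⊆ T) →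
      y ∉ K → y' ∉ K → (∃ k, k ∈ K ∧ H.Adj k y) → (∃ k, k ∈ K ∧ H.Adj k y') →
      y ≠ a → y ≠ b → y ≠ c → y' ≠ a → y' ≠ b → y' ≠ c → y ≠ y' →
      (∀ (P₁ : H.Walk y b) (P₂ : H.Walk y' c), (∀ x ∈ P₁.support, x ∉ K) → (∀ x ∈ P₂.support, x ∉ K) →
          ∃ x, x ∈ P₁.support ∧ x ∈ P₂.support) ∨
      (∀ (Q₁ : H.Walk y c) (Q₂ : H.Walk y' b), (∀ x ∈ Q₁.support, x ∉ K) → (∀ x ∈ Q₂.support, x ∉ K) →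
          ∃ x, x ∈ Q₁.support ∧ x ∈ Q₂.support) := by
  refine noDoubleClash_of_noRootedK23 H ?_
  intro A B C X X' haA hbB hcC cA cB cC cX cX' dAB dAC dAX dAX' dBC dBX dBX' dCX dCX' dXX' xA xB xC x'A x'B x'C
  have flip : ∀ {S T : Set V}, (∃ u ∈ S, ∃ v ∈ T, H.Adj u v) → ∃ u ∈ T, ∃ v ∈ S, H.Adj u v :=
    fun ⟨u, hu, v, hv, e⟩ => ⟨v, hv, u, hu, e.symm⟩
  exact hK33 (some '' A) (some '' B) (some '' C) {none} (some '' X) (some '' X')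
    (induce_connected_image_some hHp cA) (induce_connected_image_some hHp cB) (induce_connected_image_some hHp cC)
    (induce_singleton_connected Hp none) (induce_connected_image_some hHp cX) (induce_connected_image_some hHp cX')
    (disjoint_image_some dAB) (disjoint_image_some dAC) (disjoint_image_some dBC)
    (disjoint_none_image X) (disjoint_none_image X') (disjoint_image_some dXX')
    (disjoint_none_image A).symm (disjoint_image_some dAX) (disjoint_image_some dAX')
    (disjoint_none_image B).symm (disjoint_image_some dBX) (disjoint_image_some dBX')
    (disjoint_none_image C).symm (disjoint_image_some dCX) (disjoint_image_some dCX')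
    ⟨some a, ⟨a, haA, rfl⟩, none, rfl, ha.symm⟩ (adj_image_some hHp (flip xA)) (adj_image_some hHp (flip x'A))
    ⟨some b, ⟨b, hbB, rfl⟩, none, rfl, hb.symm⟩ (adj_image_some hHp (flip xB)) (adj_image_some hHp (flip x'B))
    ⟨some c, ⟨c, hcC, rfl⟩, none, rfl, hc.symm⟩ (adj_image_some hHp (flip xC)) (adj_image_some hHp (flip x'C))

/-! ### CSQ, DUU, TS -/

section Fin

variable {n : ℕ} (w : Sym2 (Fin n) → unitInterval) (a b c : Fin n) (H : SimpleGraph (Fin n)) (Hp : SimpleGraph (Option (Fin n)))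

/-- **CSQ at `(a; b, c)` without a rooted `K₂,₃` at `{a,b,c}`** (`H ⊇` positive pairs of `w`): `clusterSquare w a b c ≤ μ(b ↮ c)²`.
[cite: Gladkov2024, Thm. 4.3, Def. 4.2, Lemma 3.1, Ex. 2.5] -/
theorem clusterSquare_le_sq_of_noRootedK23 (hH : ∀ u v, u ≠ v → (0 : ℝ) < w s(u, v) → H.Adj u v)
    (hK23 : ∀ A B C X X' : Set (Fin n), a ∈ A → b ∈ B → c ∈ C →
      (H.induce A).Connected → (H.induce B).Connected → (H.induce C).Connected → (H.induce X).Connected → (H.induce X').Connected →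
      Disjoint A B → Disjoint A C → Disjoint A X → Disjoint A X' → Disjoint B C → Disjoint B X → Disjoint B X' →
      Disjoint C X → Disjoint C X' → Disjoint X X' →
      (∃ u ∈ X, ∃ v ∈ A, H.Adj u v) → (∃ u ∈ X, ∃ v ∈ B, H.Adj u v) → (∃ u ∈ X, ∃ v ∈ C, H.Adj u v) →
      (∃ u ∈ X', ∃ v ∈ A, H.Adj u v) → (∃ u ∈ X', ∃ v ∈ B, H.Adj u v) → (∃ u ∈ X', ∃ v ∈ C, H.Adj u v) → False) :
    clusterSquare w a b c ≤ (prodBernoulli w).real (openConn b c)ᶜ ^ 2 :=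
  clusterSquare_le_sq_of_unlinked w a b c H hH (noDoubleClash_of_noRootedK23 H hK23)

/-- **DUU at `(a; b, c)` without a rooted `K₂,₃` at `{a,b,c}`**: `μ(a↮b, a↮c, b↮c)² ≤ μ(a↮b, a↮c) · μ(b↮c)²`.
[cite: Gladkov2024, Thm. 5.2 and Thm. 4.3] -/
theorem sq_real_split_le_of_noRootedK23 (hH : ∀ u v, u ≠ v → (0 : ℝ) < w s(u, v) → H.Adj u v)
    (hK23 : ∀ A B C X X' : Set (Fin n), a ∈ A → b ∈ B → c ∈ C →
      (H.induce A).Connected → (H.induce B).Connected → (H.induce C).Connected → (H.induce X).Connected → (H.induce X').Connected →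
      Disjoint A B → Disjoint A C → Disjoint A X → Disjoint A X' → Disjoint B C → Disjoint B X → Disjoint B X' →
      Disjoint C X → Disjoint C X' → Disjoint X X' →
      (∃ u ∈ X, ∃ v ∈ A, H.Adj u v) → (∃ u ∈ X, ∃ v ∈ B, H.Adj u v) → (∃ u ∈ X, ∃ v ∈ C, H.Adj u v) →
      (∃ u ∈ X', ∃ v ∈ A, H.Adj u v) → (∃ u ∈ X', ∃ v ∈ B, H.Adj u v) → (∃ u ∈ X', ∃ v ∈ C, H.Adj u v) → False) :
    (prodBernoulli w).real ((openConn a b)ᶜ ∩ (openConn a c)ᶜ ∩ (openConn b c)ᶜ) ^ 2 ≤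
      (prodBernoulli w).real ((openConn a b)ᶜ ∩ (openConn a c)ᶜ) * (prodBernoulli w).real (openConn b c)ᶜ ^ 2 :=
  sq_real_split_le_of_unlinked w a b c H hH (noDoubleClash_of_noRootedK23 H hK23)

/-- **TS for `{a, b, c}` without a rooted `K₂,₃` at `{a,b,c}`** — in particular for every planar graph with `a, b, c` on a common face:
`μ(a↮b, a↮c, b↮c)² ≤ μ(a↮b) · μ(a↮c) · μ(b↮c)`. [cite: Gladkov2024, Thm. 5.2, Cor. 5.3 (pattern), Thm. 4.3 and Thm. 6.1 (planar)] -/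
theorem tripleSplit_of_noRootedK23 (hH : ∀ u v, u ≠ v → (0 : ℝ) < w s(u, v) → H.Adj u v)
    (hK23 : ∀ A B C X X' : Set (Fin n), a ∈ A → b ∈ B → c ∈ C →
      (H.induce A).Connected → (H.induce B).Connected → (H.induce C).Connected → (H.induce X).Connected → (H.induce X').Connected →
      Disjoint A B → Disjoint A C → Disjoint A X → Disjoint A X' → Disjoint B C → Disjoint B X → Disjoint B X' →
      Disjoint C X → Disjoint C X' → Disjoint X X' →
      (∃ u ∈ X, ∃ v ∈ A, H.Adj u v) → (∃ u ∈ X, ∃ v ∈ B, H.Adj u v) → (∃ u ∈ X, ∃ v ∈ C, H.Adj u v) →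
      (∃ u ∈ X', ∃ v ∈ A, H.Adj u v) → (∃ u ∈ X', ∃ v ∈ B, H.Adj u v) → (∃ u ∈ X', ∃ v ∈ C, H.Adj u v) → False) :
    (prodBernoulli w).real ((openConn a b)ᶜ ∩ (openConn a c)ᶜ ∩ (openConn b c)ᶜ) ^ 2 ≤
      (prodBernoulli w).real (openConn a b)ᶜ * (prodBernoulli w).real (openConn a c)ᶜ *
        (prodBernoulli w).real (openConn b c)ᶜ :=
  tripleSplit_of_unlinked w a b c H hH (noDoubleClash_of_noRootedK23 H hK23)

/-- **CSQ at `(a; b, c)` when the cone over `{a,b,c}` has no `K₃,₃` minor** (planar `H`, `a, b, c` on one face).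
[cite: Gladkov2024, Thm. 4.3 and Thm. 6.1] -/
theorem clusterSquare_le_sq_of_noK33Cone (hH : ∀ u v, u ≠ v → (0 : ℝ) < w s(u, v) → H.Adj u v)
    (hHp : ∀ u v, H.Adj u v → Hp.Adj (some u) (some v))
    (ha : Hp.Adj none (some a)) (hb : Hp.Adj none (some b)) (hc : Hp.Adj none (some c))
    (hK33 : ∀ L₁ L₂ L₃ R₁ R₂ R₃ : Set (Option (Fin n)),
      (Hp.induce L₁).Connected → (Hp.induce L₂).Connected → (Hp.induce L₃).Connected →
      (Hp.induce R₁).Connected → (Hp.induce R₂).Connected → (Hp.induce R₃).Connected →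
      Disjoint L₁ L₂ → Disjoint L₁ L₃ → Disjoint L₂ L₃ → Disjoint R₁ R₂ → Disjoint R₁ R₃ → Disjoint R₂ R₃ →
      Disjoint L₁ R₁ → Disjoint L₁ R₂ → Disjoint L₁ R₃ → Disjoint L₂ R₁ → Disjoint L₂ R₂ → Disjoint L₂ R₃ →
      Disjoint L₃ R₁ → Disjoint L₃ R₂ → Disjoint L₃ R₃ →
      (∃ u ∈ L₁, ∃ v ∈ R₁, Hp.Adj u v) → (∃ u ∈ L₁, ∃ v ∈ R₂, Hp.Adj u v) → (∃ u ∈ L₁, ∃ v ∈ R₃, Hp.Adj u v) →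
      (∃ u ∈ L₂, ∃ v ∈ R₁, Hp.Adj u v) → (∃ u ∈ L₂, ∃ v ∈ R₂, Hp.Adj u v) → (∃ u ∈ L₂, ∃ v ∈ R₃, Hp.Adj u v) →
      (∃ u ∈ L₃, ∃ v ∈ R₁, Hp.Adj u v) → (∃ u ∈ L₃, ∃ v ∈ R₂, Hp.Adj u v) → (∃ u ∈ L₃, ∃ v ∈ R₃, Hp.Adj u v) → False) :
    clusterSquare w a b c ≤ (prodBernoulli w).real (openConn b c)ᶜ ^ 2 :=
  clusterSquare_le_sq_of_unlinked w a b c H hH (noDoubleClash_of_noK33Cone H Hp hHp ha hb hc hK33)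

/-- **DUU at `(a; b, c)` under the cone hypothesis.** [cite: Gladkov2024, Thm. 5.2 and Thm. 4.3] -/
theorem sq_real_split_le_of_noK33Cone (hH : ∀ u v, u ≠ v → (0 : ℝ) < w s(u, v) → H.Adj u v)
    (hHp : ∀ u v, H.Adj u v → Hp.Adj (some u) (some v))
    (ha : Hp.Adj none (some a)) (hb : Hp.Adj none (some b)) (hc : Hp.Adj none (some c))
    (hK33 : ∀ L₁ L₂ L₃ R₁ R₂ R₃ : Set (Option (Fin n)),
      (Hp.induce L₁).Connected → (Hp.induce L₂).Connected → (Hp.induce L₃).Connected →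
      (Hp.induce R₁).Connected → (Hp.induce R₂).Connected → (Hp.induce R₃).Connected →
      Disjoint L₁ L₂ → Disjoint L₁ L₃ → Disjoint L₂ L₃ → Disjoint R₁ R₂ → Disjoint R₁ R₃ → Disjoint R₂ R₃ →
      Disjoint L₁ R₁ → Disjoint L₁ R₂ → Disjoint L₁ R₃ → Disjoint L₂ R₁ → Disjoint L₂ R₂ → Disjoint L₂ R₃ →
      Disjoint L₃ R₁ → Disjoint L₃ R₂ → Disjoint L₃ R₃ →
      (∃ u ∈ L₁, ∃ v ∈ R₁, Hp.Adj u v) → (∃ u ∈ L₁, ∃ v ∈ R₂, Hp.Adj u v) → (∃ u ∈ L₁, ∃ v ∈ R₃, Hp.Adj u v) →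
      (∃ u ∈ L₂, ∃ v ∈ R₁, Hp.Adj u v) → (∃ u ∈ L₂, ∃ v ∈ R₂, Hp.Adj u v) → (∃ u ∈ L₂, ∃ v ∈ R₃, Hp.Adj u v) →
      (∃ u ∈ L₃, ∃ v ∈ R₁, Hp.Adj u v) → (∃ u ∈ L₃, ∃ v ∈ R₂, Hp.Adj u v) → (∃ u ∈ L₃, ∃ v ∈ R₃, Hp.Adj u v) → False) :
    (prodBernoulli w).real ((openConn a b)ᶜ ∩ (openConn a c)ᶜ ∩ (openConn b c)ᶜ) ^ 2 ≤
      (prodBernoulli w).real ((openConn a b)ᶜ ∩ (openConn a c)ᶜ) * (prodBernoulli w).real (openConn b c)ᶜ ^ 2 :=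
  sq_real_split_le_of_unlinked w a b c H hH (noDoubleClash_of_noK33Cone H Hp hHp ha hb hc hK33)

/-- **THEOREM D — TS under the cone hypothesis**: for every weight vector whose positive-pair graph, coned over `{a,b,c}`, has no `K₃,₃`
minor — in particular every PLANAR graph with `a, b, c` on a COMMON FACE — `μ(a↮b, a↮c, b↮c)² ≤ μ(a↮b) · μ(a↮c) · μ(b↮c)`.
[cite: Gladkov2024, Thm. 5.2, Cor. 5.3 (pattern), Thm. 4.3 and Thm. 6.1 (planar)] -/
theorem tripleSplit_of_noK33Cone (hH : ∀ u v, u ≠ v → (0 : ℝ) < w s(u, v) → H.Adj u v)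
    (hHp : ∀ u v, H.Adj u v → Hp.Adj (some u) (some v))
    (ha : Hp.Adj none (some a)) (hb : Hp.Adj none (some b)) (hc : Hp.Adj none (some c))
    (hK33 : ∀ L₁ L₂ L₃ R₁ R₂ R₃ : Set (Option (Fin n)),
      (Hp.induce L₁).Connected → (Hp.induce L₂).Connected → (Hp.induce L₃).Connected →
      (Hp.induce R₁).Connected → (Hp.induce R₂).Connected → (Hp.induce R₃).Connected →
      Disjoint L₁ L₂ → Disjoint L₁ L₃ → Disjoint L₂ L₃ → Disjoint R₁ R₂ → Disjoint R₁ R₃ → Disjoint R₂ R₃ →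
      Disjoint L₁ R₁ → Disjoint L₁ R₂ → Disjoint L₁ R₃ → Disjoint L₂ R₁ → Disjoint L₂ R₂ → Disjoint L₂ R₃ →
      Disjoint L₃ R₁ → Disjoint L₃ R₂ → Disjoint L₃ R₃ →
      (∃ u ∈ L₁, ∃ v ∈ R₁, Hp.Adj u v) → (∃ u ∈ L₁, ∃ v ∈ R₂, Hp.Adj u v) → (∃ u ∈ L₁, ∃ v ∈ R₃, Hp.Adj u v) →
      (∃ u ∈ L₂, ∃ v ∈ R₁, Hp.Adj u v) → (∃ u ∈ L₂, ∃ v ∈ R₂, Hp.Adj u v) → (∃ u ∈ L₂, ∃ v ∈ R₃, Hp.Adj u v) →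
      (∃ u ∈ L₃, ∃ v ∈ R₁, Hp.Adj u v) → (∃ u ∈ L₃, ∃ v ∈ R₂, Hp.Adj u v) → (∃ u ∈ L₃, ∃ v ∈ R₃, Hp.Adj u v) → False) :
    (prodBernoulli w).real ((openConn a b)ᶜ ∩ (openConn a c)ᶜ ∩ (openConn b c)ᶜ) ^ 2 ≤
      (prodBernoulli w).real (openConn a b)ᶜ * (prodBernoulli w).real (openConn a c)ᶜ *
        (prodBernoulli w).real (openConn b c)ᶜ :=
  tripleSplit_of_unlinked w a b c H hH (noDoubleClash_of_noK33Cone H Hp hHp ha hb hc hK33)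

end Fin

end Consts

end Summit.CriticalPhenomena.PercolationContinuityZ3.Theorems
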